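import Summits.Langlands.Langlands.Theses.CMRestImageLocusSplit
import Literature.NumberTheory.Automorphic.CaraianiNewtonModularity
/-! BC3 birth skeleton for crux `IrreducibleThreeImQuadWitnessAutomorphy` (GEN3) of node/route `CMRestImageLocusSplit` (lens-5 g18): 4 named stubs (sorry) + ONE closed composition `IrreducibleThreeImQuadWitnessAutomorphy_proof` (real proof below the `have` lines). POST-BIRTH form: imports the route file and concludes the ROUTE decl by name (elaborates once Theses/CMRestImageLocusSplit.lean exists). -/
set_option linter.dupNamespace false
set_option linter.unusedVariables false
open scoped BigOperators Topology Manifold Classical MeasureTheory ProbabilityTheory Matrix InnerProductSpace ComplexConjugate ContinuousMap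
open Filter Set Function TopologicalSpace MeasureTheory
-- SKELETON SHAPE (writer-1 WORD (A)(61), bus L1461): ONE closed theorem `<Crux>_proof : <crux decl>` whose `have` lines invoke the sorried stubs; no stub is typed `… → <crux decl>`.
namespace Summit.Langlands.Langlands.Cruxes.IrreducibleThreeImQuadWitnessAutomorphy.Birth

/-- Caraiani–Newton 2023 Thm 7.1 (2) [corpus:paper-arxiv-2301.10509 p91; Lemma 7.1.1 p92]: over an imaginary quadratic F an integral E (Δ ≠ 0) with E_F[3] irreducible and mod-3 image NOT conjugate to C_s⁺(3) (rendered: not EXACTLY ⟨diag(1,2), antidiag(1,1)⟩ in any framing of E[3]) is modular. PRINT, not yet vendored (clause (1) only in CaraianiNewtonIrreducibleFive.lean) — typing request D1. -/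
theorem stub_cn71_2 :
    ∀ (F : Type) [Field F] [NumberField F], NumberField.IsTotallyComplex F → Module.finrank ℚ F = 2 → ∀ E : WeierstrassCurve (NumberField.RingOfIntegers F), E.Δ ≠ 0 → (E.baseChange F).HasIrreducibleModPGaloisRep 3 → ¬ (∃ ρ₃ : Literature.NumberTheory.GaloisRepresentations.FramedGaloisRep F (ZMod 3) 2, (∃ e : (E.baseChange F).geomTorsion ((3 : ℕ) : ℤ) ≃+ (Fin 2 → ZMod 3), ∀ (σ : Field.absoluteGaloisGroup F) (P : (E.baseChange F).geomTorsion ((3 : ℕ) : ℤ)), e (σ • P) = ((ρ₃ σ : GL (Fin 2) (ZMod 3)) : Matrix (Fin 2) (Fin 2) (ZMod 3)) *ᵥ (e P)) ∧ (∀ σ : Field.absoluteGaloisGroup F, (ρ₃ σ : GL (Fin 2) (ZMod 3)) ∈ Subgroup.closure ({(⟨!![1, 0; 0, 2], !![1, 0; 0, 2], by decide, by decide⟩ : GL (Fin 2) (ZMod 3)), (⟨!![0, 1; 1, 0], !![0, 1; 1, 0], by decide, by decide⟩ : GL (Fin 2) (ZMod 3))} : Set (GL (Fin 2) (ZMod 3))))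 ∧ (∀ n ∈ Subgroup.closure ({(⟨!![1, 0; 0, 2], !![1, 0; 0, 2], by decide, by decide⟩ : GL (Fin 2) (ZMod 3)), (⟨!![0, 1; 1, 0], !![0, 1; 1, 0], by decide, by decide⟩ : GL (Fin 2) (ZMod 3))} : Set (GL (Fin 2) (ZMod 3))), ∃ σ : Field.absoluteGaloisGroup F, (ρ₃ σ : GL (Fin 2) (ZMod 3)) = n)) → Literature.NumberTheory.Automorphic.IsModularEllipticCurve F E := by
  sorry

/-- ETP = this route's support item `CMRestImageLocusSplit.EllipticTransportPointwise` (BY NAME in the post-birth form, so the item is in the skeleton-aware cone of `closes` — BC6; text in the pre-birth form): the host transport TRANY 31038 with the witness taken through an integral model and only that curve's modularity assumed — Arthur–Clozel solvable base change of π_E along L/K₀, ⊗ the Hecke character of χ (R1), a.e. Satake match via W⁺ + Chebotarev + JS, solvable descent to K pinned by twist-primitivity (Lapid–Rogawski / Rajan). -/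
theorem stub_transport :
    Summit.Langlands.Langlands.Theses.CMRestImageLocusSplit.EllipticTransportPointwise := by
  sorry

/-- W⁺|₂ = host item `EllipticDegreeLadder.SatakeAvatarExistence` (stmt-Langlands-17415) AT n = 2, text VERBATIM the first antecedent of TRANY 31038 / ETP: every L-algebraic cuspidal π on GL₂/K has an irreducible ℓ-adic Galois avatar matching its Satake parameters a.e. (HLTT/Scholze + purity). `fun K _ _ hcpt π hL ℓ _ ι => h17415 K 2 hcpt two_pos π hL ℓ ι` closes it from the host item. -/
theorem stub_avatar2 :
    ∀ (K : Type) [Field K] [NumberField K] (hcpt : Literature.NumberTheory.Automorphic.isCompact_glFiniteIntegralLevel 2 K) (π : Literature.NumberTheory.Automorphic.CuspidalAutomorphicRepData 2 K hcpt), π.1.IsLAlgebraic → ∀ (ℓ : ℕ) [Fact ℓ.Prime] (ι : PadicAlgCl ℓ ≃+* ℂ), ∃ ρ : Literature.NumberTheory.GaloisRepresentations.FramedGaloisRep K (PadicAlgCl ℓ) 2, ρ.toGaloisRep.IsIrreducible ∧ ∀ᶠ v : IsDedekindDomain.HeightOneSpectrum (NumberField.RingOfIntegers K) in Filter.cofinite,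 SatakeFrobCompatibleAt ι π.1 ρ v := by
  sorry

/-- R1 = host item `EllipticDegreeLadder.RankOneAutomorphy` (stmt-Langlands-24805) BY NAME (cross-route by-name stub, tree precedent `stub_pairLBoundaryJS : AnalyticDescent.PairLBoundaryJS`) — automorphy of pinned-geometric ℓ-adic characters (class field theory + Weil); one proof closes both. -/
theorem stub_rankOne :
    Summit.Langlands.Langlands.Theses.EllipticDegreeLadder.RankOneAutomorphy := by
  sorry

/-- composition (real proof, no sorry outside the stubs): the stubs imply the cell. -/
theorem IrreducibleThreeImQuadWitnessAutomorphy_proof :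
    Summit.Langlands.Langlands.Theses.CMRestImageLocusSplit.IrreducibleThreeImQuadWitnessAutomorphy := by
  have hCN : (∀ (F : Type) [Field F] [NumberField F], NumberField.IsTotallyComplex F → Module.finrank ℚ F = 2 → ∀ E : WeierstrassCurve (NumberField.RingOfIntegers F), E.Δ ≠ 0 → (E.baseChange F).HasIrreducibleModPGaloisRep 3 → ¬ (∃ ρ₃ : Literature.NumberTheory.GaloisRepresentations.FramedGaloisRep F (ZMod 3) 2, (∃ e : (E.baseChange F).geomTorsion ((3 : ℕ) : ℤ) ≃+ (Fin 2 → ZMod 3), ∀ (σ : Field.absoluteGaloisGroup F) (P : (E.baseChange F).geomTorsion ((3 : ℕ) : ℤ)), e (σ • P) = ((ρ₃ σ : GL (Fin 2) (ZMod 3)) : Matrix (Fin 2) (Fin 2) (ZMod 3)) *ᵥ (e P)) ∧ (∀ σ : Field.absoluteGaloisGroup F, (ρ₃ σ : GL (Fin 2) (ZMod 3)) ∈ Subgroup.closure ({(⟨!![1, 0; 0, 2], !![1, 0; 0, 2], by decide, by decide⟩ : GL (Fin 2) (ZMod 3)), (⟨!![0, 1; 1, 0], !![0, 1; 1, 0],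 by decide, by decide⟩ : GL (Fin 2) (ZMod 3))} : Set (GL (Fin 2) (ZMod 3)))) ∧ (∀ n ∈ Subgroup.closure ({(⟨!![1, 0; 0, 2], !![1, 0; 0, 2], by decide, by decide⟩ : GL (Fin 2) (ZMod 3)), (⟨!![0, 1; 1, 0], !![0, 1; 1, 0], by decide, by decide⟩ : GL (Fin 2) (ZMod 3))} : Set (GL (Fin 2) (ZMod 3))), ∃ σ : Field.absoluteGaloisGroup F, (ρ₃ σ : GL (Fin 2) (ZMod 3)) = n)) → Literature.NumberTheory.Automorphic.IsModularEllipticCurve F E) := stub_cn71_2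
  have hT : (Summit.Langlands.Langlands.Theses.CMRestImageLocusSplit.EllipticTransportPointwise) := stub_transport
  have hW : (∀ (K : Type) [Field K] [NumberField K] (hcpt : Literature.NumberTheory.Automorphic.isCompact_glFiniteIntegralLevel 2 K) (π : Literature.NumberTheory.Automorphic.CuspidalAutomorphicRepData 2 K hcpt), π.1.IsLAlgebraic → ∀ (ℓ : ℕ) [Fact ℓ.Prime] (ι : PadicAlgCl ℓ ≃+* ℂ), ∃ ρ : Literature.NumberTheory.GaloisRepresentations.FramedGaloisRep K (PadicAlgCl ℓ) 2, ρ.toGaloisRep.IsIrreducible ∧ ∀ᶠ v : IsDedekindDomain.HeightOneSpectrum (NumberField.RingOfIntegers K) in Filter.cofinite, SatakeFrobCompatibleAt ι π.1 ρ v) := stub_avatar2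
  have h1 : (Summit.Langlands.Langlands.Theses.EllipticDegreeLadder.RankOneAutomorphy) := stub_rankOne
  intro K _ _ hcpt ℓ _ ι ρ hirr hgeo htw hP
  obtain ⟨-, -, -, -, L, _, _, _, hgal, hsol, K₀, _, _, _, hgal₀, hsol₀, hcm, hd2, E, hEll, χ, ⟨h3, hns⟩, hvia⟩ := hP
  have htc : NumberField.IsTotallyComplex K₀ := hcm.to_isTotallyComplex
  have hΔ : E.Δ ≠ 0 := by
    intro h0
    have hu := (E.baseChange K₀).isUnit_Δ
    simp only [WeierstrassCurve.baseChange, WeierstrassCurve.map_Δ, h0, map_zero, isUnit_zero_iff] at hu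
    exact zero_ne_one hu
  exact hT hW h1 K hcpt ℓ ι ρ hirr hgeo htw L hgal hsol K₀ hgal₀ hsol₀ E χ hvia (hCN K₀ htc hd2 E hΔ h3 hns)

end Summit.Langlands.Langlands.Cruxes.IrreducibleThreeImQuadWitnessAutomorphy.Birth
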